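import Mathlib.Algebra.BigOperators.Group.Finset.Basic
import Mathlib.Algebra.Order.BigOperators.Ring.Finset
import Mathlib.Data.Fintype.Pi
import Mathlib.Data.Fintype.BigOperators
import Mathlib.Tactic
import HarnessLib

/-!
# Binary cubes: pattern counts and the sumset of a cube with a sub-cube

Topic `Literature/Combinatorics/Additive`. Fully proved, elementary (folklore on dissociated /
binary "cubes" `P_b = {Σ_{j ∈ b} u_j w_j : u_j ∈ {0,1}}`, e.g. the self-similar sumset growth used
for digit sets and Cantor-like sets):

* `card_patterns_eq` — the Boolean patterns supported on a mask `a` number `2^{|a|}`;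
* `card_cube_add_subcube_le` — for `b'' ⊆ b`, the sumset `P_b + P_{b''}` has at most
  `3^{|b''|} · 2^{|b ∖ b''|}` elements (each digit of `b''` carries a coefficient in `{0,1,2}`),
  i.e. `|P_b + P_{b''}| ≤ (3/4)^{|b''|} |P_b| |P_{b''}|` — cubes have small sumsets with their
  own sub-cubes;
* `card_filter_and_not` — `|b ∖ b''| = |b| − |b''|` for `b'' ⊆ b` (bookkeeping).

Consumer: the spread-set energy bound of the DLOG band (crux `DlogGraphFlat`, `Summits/QuantumAdvantage`).
-/

namespace Literature.Combinatorics.Additive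

open Finset

variable {n : ℕ}

/-- The patterns supported on a mask, as a `piFinset`. [folklore] -/
theorem image_and_eq_piFinset (a : Fin n → Bool) :
    (Finset.univ.image fun u : Fin n → Bool => fun j => u j && a j) =
      Fintype.piFinset fun j => if a j = true then (Finset.univ : Finset Bool) else {false} := by
  ext u
  simp only [Finset.mem_image, Finset.mem_univ, true_and, Fintype.mem_piFinset]
  constructor
  · rintro ⟨v, rfl⟩ j
    dsimp only
    cases a j <;> simp
  · intro h
    refine ⟨u, funext fun j => ?_⟩
    have hj := h j
    revert hj
    cases a j <;> cases u j <;> simp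

/-- **Pattern count**: the Boolean patterns supported on a mask `a` number exactly `2^{|a|}`. [folklore] -/
theorem card_patterns_eq (a : Fin n → Bool) :
    (Finset.univ.image fun u : Fin n → Bool => fun j => u j && a j).card =
      2 ^ (Finset.univ.filter fun j => a j = true).card := by
  rw [image_and_eq_piFinset, Fintype.card_piFinset]
  have hTj : ∀ j : Fin n,
      (if a j = true then (Finset.univ : Finset Bool) else {false}).card = if a j = true then 2 else 1 := by
    intro j; split_ifs <;> simp
  rw [Finset.prod_congr rfl (fun j _ => hTj j), Finset.prod_ite, Finset.prod_const, Finset.prod_const_one,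
    mul_one]

/-- Bookkeeping: `|b ∖ b''| = |b| − |b''|` for `b'' ⊆ b`. [folklore] -/
theorem card_filter_and_not (b b'' : Fin n → Bool) (hsub : ∀ j, b'' j = true → b j = true) :
    (Finset.univ.filter fun j => b j = true ∧ b'' j = false).card =
      (Finset.univ.filter fun j => b j = true).card - (Finset.univ.filter fun j => b'' j = true).card := by
  have hsub' : (Finset.univ.filter fun j => b'' j = true) ⊆ Finset.univ.filter fun j => b j = true := by
    intro j hj
    rw [Finset.mem_filter] at hj ⊢
    exact ⟨hj.1, hsub j hj.2⟩
  rw [← Finset.card_sdiff_of_subset hsub']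
  congr 1
  ext j
  simp only [Finset.mem_sdiff, Finset.mem_filter, Finset.mem_univ, true_and]
  cases b'' j <;> simp

/-- **Cube plus sub-cube**: for masks `b'' ⊆ b` and weights `w`, the sums
`Σ_j ([u_j ∧ b_j] + [u''_j ∧ b''_j]) w_j` over all pattern pairs take at most
`3^{|b''|} · 2^{|b ∖ b''|}` values. [folklore] -/
theorem card_cube_add_subcube_le {M : Type*} [AddCommMonoid M] [DecidableEq M] (w : Fin n → M)
    (b b'' : Fin n → Bool) (hsub : ∀ j, b'' j = true → b j = true) :
    ((Finset.univ ×ˢ Finset.univ).image fun uu : (Fin n → Bool) × (Fin n → Bool) =>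
        ∑ j, ((uu.1 j && b j).toNat + (uu.2 j && b'' j).toNat) • w j).card ≤
      3 ^ (Finset.univ.filter fun j => b'' j = true).card *
        2 ^ (Finset.univ.filter fun j => b j = true ∧ b'' j = false).card := by
  classical
  set T : Fin n → Finset ℕ := fun j =>
    if b'' j = true then {0, 1, 2} else if b j = true then {0, 1} else {0} with hT
  have hsubset : ((Finset.univ ×ˢ Finset.univ).image fun uu : (Fin n → Bool) × (Fin n → Bool) =>
        ∑ j, ((uu.1 j && b j).toNat + (uu.2 j && b'' j).toNat) • w j) ⊆
      (Fintype.piFinset T).image fun t => ∑ j, t j • w j := by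
    intro x hx
    rw [Finset.mem_image] at hx ⊢
    obtain ⟨uu, _, rfl⟩ := hx
    refine ⟨fun j => (uu.1 j && b j).toNat + (uu.2 j && b'' j).toNat, ?_, rfl⟩
    rw [Fintype.mem_piFinset]
    intro j
    rw [hT]
    dsimp only
    have h1 := hsub j
    revert h1
    cases uu.1 j <;> cases uu.2 j <;> cases b j <;> cases b'' j <;> simp
  refine (Finset.card_le_card hsubset).trans (Finset.card_image_le.trans ?_)
  rw [Fintype.card_piFinset]
  have hTcard : ∀ j, (T j).card = if b'' j = true then 3 else if b j = true ∧ b'' j = false then 2 else 1 := by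
    intro j
    rw [hT]
    dsimp only
    have h1 := hsub j
    revert h1
    cases b j <;> cases b'' j <;> simp
  rw [Finset.prod_congr rfl (fun j _ => hTcard j), Finset.prod_ite, Finset.prod_const, Finset.prod_ite,
    Finset.prod_const, Finset.prod_const_one, mul_one]
  refine le_of_eq ?_
  congr 2
  rw [Finset.filter_filter]
  congr 1
  ext j
  simp only [Finset.mem_filter, Finset.mem_univ, true_and]
  cases b j <;> cases b'' j <;> simp

end Literature.Combinatorics.Additive
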